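import Summits.AtomisticToContinuum.HydrodynamicLimit.Theorems.BoxDissipativeWeakStrongEntropyAdmissibilityDynamicCore
import Summits.AtomisticToContinuum.HydrodynamicLimit.Theorems.BoxDissipativeWeakStrongEntropyAdmissibilityStubConcentrationOfPTBCInBand

/-!
# Crux `EntropyAdmissibility` (stmt-AtomisticToContinuum-9903), line `registered` — stub `stub_cruxOfOpenStubs`

The line's COMPOSITION, in the tree: the crux `BoxDissipativeWeakStrong.EntropyAdmissibility` follows from its two open
stubs — the annealed local entropy deficit bound S1b (`stub_meanEntropyDeficit`: in the crux's frame, `∀ ε > 0`, eventually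
`E_{P_N}[A_N] + B ≤ ε`) and the in-band positive-time box concentration S2a' (`stub_positiveTimeBoxConcentrationInBand`,
reshape r6) — over the LANDED pieces S0, S1a, S2b' (`EABirthS2bG`) and the dynamic-core sandwich (`EABirthCore`, p156387):

  `S1b → S2a' → EntropyAdmissibility`
    `= crux_of_inFrame_dyn ∘ inFrame_dyn_of_def_of_conc S1b (S2b' S2a')`.

This is the conditional form of the crux that a re-lining of stmt-9903 into the route header's foreseen children
`MeanLocalEntropyInequality` (= S1b) and `PositiveTimeBoxConcentration` (= S2a') would cite; it credits nothing by itself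
(both hypotheses are open problems: weak local equilibrium of deterministic hard spheres at positive times, in mean resp. at
the level of fluctuations).

References: J. Březina, E. Feireisl, J. Math. Soc. Japan 70 (2018), Def. 2.9; H. Spohn (1991), Part I Ch. 3.
-/

noncomputable section

open MeasureTheory Filter Set
open scoped ENNReal Topology

namespace Summit.AtomisticToContinuum.HydrodynamicLimit.Theorems.EABirthAssembly

open Literature.MathematicalPhysics.KineticTheory
open Summit.AtomisticToContinuum.HydrodynamicLimit.Theses
open Summit.AtomisticToContinuum.HydrodynamicLimit.Theorems.BDWS

/-- **Signature of the registered stub `stub_cruxOfOpenStubs`** (definitionally the skeleton's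
`Sig.stub_meanEntropyDeficit → Sig.stub_positiveTimeBoxConcentrationInBand → BoxDissipativeWeakStrong.EntropyAdmissibility`;
S1b is `EABirthCore.InFrame EABirthCore.Cdef`, S2a' is inlined verbatim). -/
def Sig.stub_cruxOfOpenStubs : Prop :=
  EABirthCore.InFrame EABirthCore.Cdef →
    (BoxDissipativeWeakStrong.HsEosLowDensity →
      ∃ ηc : ℝ, 0 < ηc ∧ ∀ η₁ : ℝ, 0 < η₁ → η₁ < ηc →
        ∀ (a₀ θ₀ : T3 → ℝ) (u₀ : T3 → V3), Continuous a₀ → Continuous θ₀ → Continuous u₀ →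
          (∀ x, 0 < a₀ x) → (∀ x, 0 < θ₀ x) →
          ∃ σ₀ : ℝ, 0 < σ₀ ∧ ∀ σ : ℝ, 0 < σ → σ < σ₀ →
            ∀ (T : ℝ) (ρ θ : ℝ → T3 → ℝ) (u : ℝ → T3 → V3), IsHardSphereEulerSolution σ T ρ u θ →
              (∀ t ∈ Ico 0 T, ∀ x, ρ t x * σ ^ 3 ≤ η₁ / 2) →
              ∀ Φ : FlowFamily σ,
                TendstoHydroFieldsAt (fun N => localGibbsLaw σ a₀ u₀ θ₀ N (Φ N)) Φ ρ u θ 0 →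
                ∀ ℓ : ℕ → ℝ, (∀ N, 0 < ℓ N ∧ ℓ N ≤ 1) → Tendsto ℓ atTop (𝓝 0) →
                  Tendsto (fun N : ℕ => ℓ N ^ 3 * ((N : ℝ) + 1)) atTop atTop →
                  ∀ t ∈ Ico 0 T, ∀ G : ℝ × V3 × ℝ → ℝ, Measurable G → (∀ p, |G p| ≤ |p.1| + ‖p.2.1‖) →
                    ∀ ψ : T3 → ℝ, Continuous ψ →
                      Tendsto (fun N : ℕ => ∫⁻ z, ENNReal.ofReal
                          |(∫ x, G (boxDensity σ ℓ Φ N t z x, boxMomentum σ ℓ Φ N t z x,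
                              boxEnergy σ ℓ Φ N t z x) * ψ x) -
                            ∫ z', (∫ x, G (boxDensity σ ℓ Φ N t z' x, boxMomentum σ ℓ Φ N t z' x,
                              boxEnergy σ ℓ Φ N t z' x) * ψ x) ∂(localGibbsLaw σ a₀ u₀ θ₀ N (Φ N))|
                        ∂(localGibbsLaw σ a₀ u₀ θ₀ N (Φ N))) atTop (𝓝 0)) →
      BoxDissipativeWeakStrong.EntropyAdmissibility

/-- **Registered stub `stub_cruxOfOpenStubs`** (crux stmt-AtomisticToContinuum-9903, line `registered`): the crux from its
two open stubs S1b and S2a', by the landed sandwich (`S1b → S2 → DynCore → crux`) and the landed S2b' (`S2a' → S2`). -/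
theorem stub_cruxOfOpenStubs : Sig.stub_cruxOfOpenStubs := fun h₁ h₂ =>
  EABirthCore.crux_of_inFrame_dyn
    (EABirthCore.inFrame_dyn_of_def_of_conc h₁ (EABirthS2bG.stub_entropyBalanceConcentration_of_PTBCInBand h₂))

end Summit.AtomisticToContinuum.HydrodynamicLimit.Theorems.EABirthAssembly

end
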